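import Summits.KontsevichZagierPeriods.KontsevichZagierPeriods.Theorems.SoloInformedAlgRealPiece
import Literature.Barriers.Schanuel.AlgebraicIndependenceOfLogarithms
import HarnessLib
import HarnessLib.Audit

/-!
# SoloInformed — algebraic independence of Baker values from the conjecture on algebraic independence of logarithms

Solo programme `solo-KontsevichZagierPeriods-informed`, session s119, file 1 (of 2): the
TRANSCENDENCE INPUT of the Baker-ring theorem (file 2, `SoloInformedBakerRing`).

*Baker values* (`soloInformedBakerValues`) are the real numbers `a + Σ_k Re(g_k · Log c_k)` with
`a` real algebraic, `g_k, c_k` complex algebraic and `c_k` in the slit plane (principal logarithm).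
By the census of values (`soloInformed_exists_value_eq_baker_K`, file 19 of s112) these are exactly
the shapes of the values of absolutely convergent one-variable integrals `∫_D N/M dx` with real
algebraic coefficients, and of every element of the span of points and segments.

Main result (`soloInformed_algebraicIndependent_of_algIndepLogarithms`): **assuming the conjecture
on algebraic independence of logarithms of algebraic numbers**
(`Literature.Barriers.Schanuel.AlgIndepLogarithms`, [Waldschmidt 2000, Conj. 1.15; a consequence
of Schanuel's conjecture, `algIndepLogarithms_of_schanuel`]), a finite family `e` of Baker values
such that `(1, e)` is linearly independent over the field `K = ℚ̄ ∩ ℝ` of real algebraic numbers is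
ALGEBRAICALLY independent over `K`.

Proof: over `ℂ`, `Re(g Log c) = (g Log c + ḡ Log c̄)/2` (`Complex.log_conj`), so each `e_i` is a
`ℚ̄`-linear combination of `1` and finitely many logarithms `λ` of non-zero algebraic numbers; a
maximal `ℚ`-linearly independent subfamily `μ` of these is algebraically independent over `ℚ` by
the conjecture, hence over `ℚ̄` (`AlgebraicIndependent.algebraicClosure`); writing
`e_i = α_i + Σ_j β_ij μ_j`, the `K`-independence of `(1, e)` makes the rows `β_i` linearly
independent over `ℚ̄` (real and imaginary parts), so the affine substitution
`X_i ↦ α_i + Σ_j β_ij Y_j` has a left inverse and is injective on polynomial rings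
(`soloInformed_aeval_affine_injective`); a polynomial relation among the `e_i` over `K` therefore
gives one among the `μ_j` over `ℚ̄`, which is trivial.

Honest placement (informed membrane: tree searched by NAME only): `lean search` for
`AlgebraicIndependent` / `algebraicIndependent_of` under `Summits/KontsevichZagierPeriods` finds only
linear-independence and four-exponentials material; the Literature side has the conjecture and its
toric/Grothendieck scope (`Literature/Barriers/Schanuel/*`), not this statement.

References: A. Baker, *Transcendental Number Theory* (1975), Ch. 2; M. Waldschmidt, *Diophantine
Approximation on Linear Algebraic Groups* (2000), §1.4 (Conj. 1.15); M. Kontsevich, D. Zagier,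
*Periods* (2001), §1.1–1.2.
-/

noncomputable section

open scoped BigOperators ComplexConjugate

namespace Summit.KontsevichZagierPeriods.KontsevichZagierPeriods.Theorems

open Set
open Literature.NumberTheory.Transcendental (isAlgebraic_re_im)
open Literature.Barriers.Schanuel (AlgIndepLogarithms)

/-! ### Baker values -/

/-- **Baker values**: real numbers `a + Σ_k Re(g_k · Log c_k)` with `a` real algebraic, `g_k, c_k`
algebraic, `c_k` in the slit plane — the elements of Baker's module of linear forms in logarithms
that are values of one-variable rational integrals with real algebraic coefficients
(`soloInformed_exists_value_eq_baker_K`). [Baker 1975, Ch. 2; this work] -/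
def soloInformedBakerValues : Set ℝ :=
  {v | ∃ (a : ℝ) (_ : IsAlgebraic ℚ a) (A : ℕ) (g c : Fin A → ℂ),
    (∀ k, IsAlgebraic ℚ (g k) ∧ IsAlgebraic ℚ (c k) ∧ c k ∈ Complex.slitPlane) ∧
    v = a + ∑ k, (g k * Complex.log (c k)).re}

/-- Real algebraic numbers are Baker values. -/
theorem soloInformed_mem_bakerValues_of_isAlgebraic {a : ℝ} (ha : IsAlgebraic ℚ a) :
    a ∈ soloInformedBakerValues :=
  ⟨a, ha, 0, Fin.elim0, Fin.elim0, fun k => k.elim0, by simp⟩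

/-- `Re(g · Log c)` is a Baker value for admissible `g, c`. -/
theorem soloInformed_re_mul_log_mem_bakerValues {g c : ℂ} (hg : IsAlgebraic ℚ g)
    (hc : IsAlgebraic ℚ c) (hc' : c ∈ Complex.slitPlane) :
    (g * Complex.log c).re ∈ soloInformedBakerValues :=
  ⟨0, isAlgebraic_zero, 1, fun _ => g, fun _ => c, fun _ => ⟨hg, hc, hc'⟩, by simp⟩

/-- Over `ℂ`: `Re(g · Log c) = (g/2) Log c + (ḡ/2) Log c̄` for `c` in the slit plane
(`Log c̄ = conj (Log c)` off the negative real axis). [folklore] -/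
theorem soloInformed_ofReal_re_mul_log {c : ℂ} (g : ℂ) (hc : c ∈ Complex.slitPlane) :
    (((g * Complex.log c).re : ℝ) : ℂ) =
      g / 2 * Complex.log c + conj g / 2 * Complex.log (conj c) := by
  rw [Complex.re_eq_add_conj, map_mul, Complex.log_conj c (Complex.slitPlane_arg_ne_pi hc)]
  ring

/-- Multiples by algebraic numbers stay in a `ℚ̄`-span. -/
theorem soloInformed_mul_mem_span_algClosure {Λ : Set ℂ} {x y : ℂ} (hx : IsAlgebraic ℚ x)
    (hy : y ∈ Submodule.span (algebraicClosure ℚ ℂ) Λ) :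
    x * y ∈ Submodule.span (algebraicClosure ℚ ℂ) Λ :=
  Submodule.smul_mem _ (⟨x, mem_algebraicClosure_iff.2 hx⟩ : algebraicClosure ℚ ℂ) hy

/-- **A Baker value is a `ℚ̄`-linear combination of `1` and finitely many logarithms of non-zero
algebraic numbers.** [Baker 1975, Ch. 2; folklore] -/
theorem soloInformed_bakerValue_mem_span {v : ℝ} (hv : v ∈ soloInformedBakerValues) :
    ∃ Λ : Set ℂ, Λ.Finite ∧ (∀ z ∈ Λ, IsAlgebraic ℚ (Complex.exp z)) ∧
      (v : ℂ) ∈ Submodule.span (algebraicClosure ℚ ℂ) (insert 1 Λ) := by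
  obtain ⟨a, ha, A, g, c, hadm, rfl⟩ := hv
  refine ⟨Set.range (fun k => Complex.log (c k)) ∪ Set.range (fun k => Complex.log (conj (c k))),
    (Set.finite_range _).union (Set.finite_range _), ?_, ?_⟩
  · rintro z (⟨k, rfl⟩ | ⟨k, rfl⟩)
    · simp only [Complex.exp_log (Complex.slitPlane_ne_zero (hadm k).2.2)]
      exact (hadm k).2.1
    · simp only [Complex.exp_log ((map_ne_zero _).2 (Complex.slitPlane_ne_zero (hadm k).2.2))]
      exact (hadm k).2.1.algHom ((starRingEnd ℂ : ℂ →+* ℂ).toRatAlgHom)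
  · set Λ := Set.range (fun k => Complex.log (c k)) ∪ Set.range (fun k => Complex.log (conj (c k)))
      with hΛ
    have h2 : IsAlgebraic ℚ (2 : ℂ)⁻¹ := (isAlgebraic_nat 2).inv
    push_cast
    refine add_mem ?_ (Submodule.sum_mem _ fun k _ => ?_)
    · rw [← mul_one ((a : ℝ) : ℂ)]
      exact soloInformed_mul_mem_span_algClosure (by simpa using ha.algebraMap (A := ℂ))
        (Submodule.subset_span (Set.mem_insert _ _))
    · rw [soloInformed_ofReal_re_mul_log (g k) (hadm k).2.2]
      refine add_mem ?_ ?_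
      · rw [div_eq_mul_inv]
        exact soloInformed_mul_mem_span_algClosure ((hadm k).1.mul h2)
          (Submodule.subset_span (Set.mem_insert_of_mem _ (Or.inl ⟨k, rfl⟩)))
      · rw [div_eq_mul_inv]
        exact soloInformed_mul_mem_span_algClosure
          (((hadm k).1.algHom ((starRingEnd ℂ : ℂ →+* ℂ).toRatAlgHom)).mul h2)
          (Submodule.subset_span (Set.mem_insert_of_mem _ (Or.inr ⟨k, rfl⟩)))

/-! ### Complexification of `K`-linear independence -/

/-- If `(1, e)` (`e` real) is linearly independent over the real algebraic numbers, then it is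
linearly independent over the complex algebraic numbers: a relation `d₀ + Σ d_i e_i = 0` with
algebraic `d₀, d_i ∈ ℂ` is trivial (real and imaginary parts are real algebraic relations).
[folklore] -/
theorem soloInformed_linIndep_complexify {ι : Type*} [Fintype ι] {e : ι → ℝ}
    (hli : LinearIndependent (algebraicClosure ℚ ℝ) (fun o : Option ι => o.elim (1 : ℝ) e))
    {d₀ : ℂ} {d : ι → ℂ} (hd₀ : IsAlgebraic ℚ d₀) (hd : ∀ i, IsAlgebraic ℚ (d i))
    (h : d₀ + ∑ i, d i * (e i : ℂ) = 0) : d₀ = 0 ∧ ∀ i, d i = 0 := by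
  classical
  have key : ∀ (L : ℂ →ₗ[ℝ] ℝ), (∀ z, IsAlgebraic ℚ z → IsAlgebraic ℚ (L z)) →
      L d₀ = 0 ∧ ∀ i, L (d i) = 0 := by
    intro L hL
    let gK : Option ι → algebraicClosure ℚ ℝ := fun o => o.elim
      (⟨L d₀, mem_algebraicClosure_iff.2 (hL _ hd₀)⟩)
      (fun i => ⟨L (d i), mem_algebraicClosure_iff.2 (hL _ (hd i))⟩)
    have h1 : ∀ i, L (d i * (e i : ℂ)) = L (d i) * e i := by
      intro i
      rw [mul_comm, ← Complex.real_smul, map_smul, smul_eq_mul, mul_comm]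
    have hL0 : L d₀ + ∑ i, L (d i) * e i = 0 := by
      have := congrArg L h
      rw [map_zero, map_add, map_sum] at this
      simpa only [h1] using this
    have hsum : ∑ o, gK o • (o.elim (1 : ℝ) e : ℝ) = 0 := by
      rw [Fintype.sum_option]
      change L d₀ * 1 + ∑ i, L (d i) * e i = 0
      rw [mul_one]
      exact hL0
    have hz := (Fintype.linearIndependent_iff.1 hli) gK hsum
    refine ⟨?_, fun i => ?_⟩
    · have := congrArg Subtype.val (hz none)
      simpa [gK] using this
    · have := congrArg Subtype.val (hz (some i))
      simpa [gK] using this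
  obtain ⟨hre₀, hre⟩ := key Complex.reLm fun z hz => by simpa using (isAlgebraic_re_im hz).1
  obtain ⟨him₀, him⟩ := key Complex.imLm fun z hz => by simpa using (isAlgebraic_re_im hz).2
  exact ⟨Complex.ext (by simpa using hre₀) (by simpa using him₀),
    fun i => Complex.ext (by simpa using hre i) (by simpa using him i)⟩

/-! ### Logarithm bases and the conjecture -/

/-- From a finite set `Λ` of logarithms of non-zero algebraic numbers, the conjecture on algebraic
independence of logarithms extracts a `ℚ`-basis `μ ⊆ Λ` of its `ℚ`-span which is algebraically
independent over `ℚ̄` (`AlgIndepLogarithms` gives independence over `ℚ`;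
`AlgebraicIndependent.algebraicClosure` lifts it to `ℚ̄`). [Waldschmidt 2000, Conj. 1.15] -/
theorem soloInformed_exists_logBasis (hAIL : AlgIndepLogarithms) {Λ : Set ℂ} (hΛ : Λ.Finite)
    (hexp : ∀ z ∈ Λ, IsAlgebraic ℚ (Complex.exp z)) :
    ∃ μ : Finset ℂ, (↑μ : Set ℂ) ⊆ Λ ∧ Λ ⊆ (Submodule.span ℚ (↑μ : Set ℂ) : Set ℂ) ∧
      AlgebraicIndependent (algebraicClosure ℚ ℂ) ((↑) : μ → ℂ) := by
  classical
  obtain ⟨b, hbΛ, hspan, hbli⟩ := exists_linearIndependent ℚ Λ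
  obtain ⟨μ, rfl⟩ : ∃ μ : Finset ℂ, (↑μ : Set ℂ) = b :=
    ⟨(hΛ.subset hbΛ).toFinset, Set.Finite.coe_toFinset _⟩
  refine ⟨μ, hbΛ, fun z hz => ?_, ?_⟩
  · rw [hspan]
    exact Submodule.subset_span hz
  · have hℚ : AlgebraicIndependent ℚ ((↑) : μ → ℂ) := by
      let E := (Fintype.equivFin μ).symm
      have h := hAIL _ ((↑) ∘ E) (fun i => hexp _ (hbΛ (E i).2)) (hbli.comp _ E.injective)
      exact (algebraicIndependent_equiv E).1 h
    exact hℚ.algebraicClosure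

/-- Coefficients of an element of the `ℚ̄`-span of `1` and a finite set `μ`. -/
theorem soloInformed_exists_coeffs_of_mem_span {μ : Finset ℂ} {z : ℂ}
    (hz : z ∈ Submodule.span (algebraicClosure ℚ ℂ) (insert 1 (↑μ : Set ℂ))) :
    ∃ (α : algebraicClosure ℚ ℂ) (β : μ → algebraicClosure ℚ ℂ),
      z = (α : ℂ) + ∑ j : μ, (β j : ℂ) * (j : ℂ) := by
  rw [Submodule.mem_span_insert] at hz
  obtain ⟨α, w, hw, rfl⟩ := hz
  have hrange : (↑μ : Set ℂ) = Set.range ((↑) : μ → ℂ) := by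
    ext x
    simp
  rw [hrange, Submodule.mem_span_range_iff_exists_fun] at hw
  obtain ⟨β, rfl⟩ := hw
  refine ⟨α, β, ?_⟩
  simp only [Algebra.smul_def, mul_one]
  rfl

/-! ### Injectivity of affine substitutions -/

/-- **An affine substitution with linearly independent linear parts is injective on polynomial
rings**: if the rows `β_i ∈ F^κ` are linearly independent, then
`X_i ↦ α_i + Σ_j β_ij Y_j` is an injective `F`-algebra map `F[X_ι] → F[Y_κ]` (a left inverse of
the matrix `β` gives a left inverse substitution). [folklore] -/
theorem soloInformed_aeval_affine_injective {F : Type*} [Field F] {ι κ : Type*} [Fintype ι]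
    [Fintype κ] [DecidableEq ι] [DecidableEq κ] (α : ι → F) (β : ι → κ → F)
    (hrows : ∀ d : ι → F, ∑ i, d i • β i = 0 → d = 0) :
    Function.Injective (MvPolynomial.aeval (R := F) (S₁ := MvPolynomial κ F)
      fun i => MvPolynomial.C (α i) + ∑ j, MvPolynomial.C (β i j) * MvPolynomial.X j) := by
  -- the linear map `d ↦ Σ_i d_i β_i` and a left inverse
  let Fr : (ι → F) →ₗ[F] (κ → F) :=
    { toFun := fun d => ∑ i, d i • β i
      map_add' := fun d d' => by
        simp only [Pi.add_apply, add_smul, Finset.sum_add_distrib]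
      map_smul' := fun s d => by
        simp only [Pi.smul_apply, smul_eq_mul, RingHom.id_apply, Finset.smul_sum, smul_smul] }
  have hFr : ∀ d, Fr d = ∑ i, d i • β i := fun d => rfl
  have hker : LinearMap.ker Fr = ⊥ := LinearMap.ker_eq_bot'.2 fun d hd => hrows d (by rwa [hFr] at hd)
  obtain ⟨G, hG⟩ := Fr.exists_leftInverse_of_injective hker
  have hFr_single : ∀ i, Fr (Pi.single i 1) = β i := by
    intro i
    rw [hFr]
    simp only [Pi.single_apply, ite_smul, one_smul, zero_smul, Finset.sum_ite_eq',
      Finset.mem_univ, if_true]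
  have hGβ : ∀ i, G (β i) = Pi.single i 1 := by
    intro i
    have := LinearMap.congr_fun hG (Pi.single i 1)
    rw [LinearMap.comp_apply, hFr_single, LinearMap.id_apply] at this
    exact this
  have hβsum : ∀ i, ∑ j, β i j • (Pi.single j (1 : F) : κ → F) = β i := by
    intro i
    funext j'
    simp only [Finset.sum_apply, Pi.smul_apply, Pi.single_apply, smul_eq_mul, mul_ite, mul_one,
      mul_zero, Finset.sum_ite_eq, Finset.mem_univ, if_true]
  -- the two substitutions
  set Φ : MvPolynomial ι F →ₐ[F] MvPolynomial κ F := MvPolynomial.aeval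
    fun i => MvPolynomial.C (α i) + ∑ j, MvPolynomial.C (β i j) * MvPolynomial.X j with hΦ
  let Y : ι → MvPolynomial ι F := fun i' => MvPolynomial.X i' - MvPolynomial.C (α i')
  let Ψ : MvPolynomial κ F →ₐ[F] MvPolynomial ι F := MvPolynomial.aeval
    fun j => ∑ i', G (Pi.single j 1) i' • Y i'
  have hΨX : ∀ j, Ψ (MvPolynomial.X j) = ∑ i', G (Pi.single j 1) i' • Y i' := fun j =>
    MvPolynomial.aeval_X _ j
  have hΨC : ∀ a, Ψ (MvPolynomial.C a) = MvPolynomial.C a := fun a => MvPolynomial.algHom_C Ψ a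
  have key : ∀ i, Ψ (Φ (MvPolynomial.X i)) = MvPolynomial.X i := by
    intro i
    have h1 : Φ (MvPolynomial.X i) =
        MvPolynomial.C (α i) + ∑ j, MvPolynomial.C (β i j) * MvPolynomial.X j :=
      MvPolynomial.aeval_X _ i
    have h2 : ∀ j, MvPolynomial.C (β i j) * Ψ (MvPolynomial.X j) =
        ∑ i', (β i j * G (Pi.single j 1) i') • Y i' := by
      intro j
      rw [hΨX, Finset.mul_sum]
      refine Finset.sum_congr rfl fun i' _ => ?_
      rw [MvPolynomial.C_mul', smul_smul]
    have h3 : ∀ i', ∑ j, β i j * G (Pi.single j 1) i' = (Pi.single i (1 : F) : ι → F) i' := by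
      intro i'
      have : ∑ j, β i j * G (Pi.single j 1) i' =
          (G (∑ j, β i j • (Pi.single j (1 : F) : κ → F))) i' := by
        rw [map_sum, Finset.sum_apply]
        refine Finset.sum_congr rfl fun j _ => ?_
        rw [map_smul, Pi.smul_apply, smul_eq_mul]
      rw [this, hβsum i, hGβ i]
    rw [h1, map_add, hΨC, map_sum]
    simp_rw [map_mul, hΨC, h2]
    rw [Finset.sum_comm]
    simp_rw [← Finset.sum_smul, h3]
    simp only [Pi.single_apply, ite_smul, one_smul, zero_smul, Finset.sum_ite_eq',
      Finset.mem_univ, if_true, Y]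
    abel
  have hΨΦ : Ψ.comp Φ = AlgHom.id F _ := MvPolynomial.algHom_ext fun i => by
    rw [AlgHom.comp_apply, AlgHom.id_apply, key]
  exact Function.LeftInverse.injective (g := Ψ) fun p => by
    rw [← AlgHom.comp_apply, hΨΦ, AlgHom.id_apply]

/-! ### The theorem -/

/-- **Assuming the conjecture on algebraic independence of logarithms, Baker values `e_i` with
`(1, e)` linearly independent over the real algebraic numbers `K` are algebraically independent
over `K`.** In particular any finite family of values of absolutely convergent one-variable
rational integrals with real algebraic coefficients that is `K`-linearly independent together with
`1` is algebraically independent. [Waldschmidt 2000, Conj. 1.15 (hypothesis); this work] -/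
theorem soloInformed_algebraicIndependent_of_algIndepLogarithms (hAIL : AlgIndepLogarithms)
    {ι : Type*} [Fintype ι] (e : ι → ℝ) (he : ∀ i, e i ∈ soloInformedBakerValues)
    (hli : LinearIndependent (algebraicClosure ℚ ℝ) (fun o : Option ι => o.elim (1 : ℝ) e)) :
    AlgebraicIndependent (algebraicClosure ℚ ℝ) e := by
  classical
  -- Step 1: the logarithms involved and an algebraically independent `ℚ`-basis `μ`
  choose Λi hΛifin hΛiexp hΛimem using fun i => soloInformed_bakerValue_mem_span (he i)
  set Λ : Set ℂ := ⋃ i, Λi i with hΛdef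
  have hΛfin : Λ.Finite := Set.finite_iUnion hΛifin
  have hΛexp : ∀ z ∈ Λ, IsAlgebraic ℚ (Complex.exp z) := by
    intro z hz
    obtain ⟨i, hi⟩ := Set.mem_iUnion.1 hz
    exact hΛiexp i z hi
  obtain ⟨μ, hμΛ, hΛμ, hμ⟩ := soloInformed_exists_logBasis hAIL hΛfin hΛexp
  -- Step 2: `e_i = α_i + Σ_j β_ij μ_j` over `ℚ̄`
  have hspan : ∀ i, (e i : ℂ) ∈
      Submodule.span (algebraicClosure ℚ ℂ) (insert 1 (↑μ : Set ℂ)) := by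
    intro i
    refine (Submodule.span_le.2 ?_) (hΛimem i)
    rintro z (rfl | hz)
    · exact Submodule.subset_span (Set.mem_insert _ _)
    · have hzΛ : z ∈ Λ := Set.mem_iUnion.2 ⟨i, hz⟩
      have h2 : Submodule.span ℚ (↑μ : Set ℂ) ≤
          (Submodule.span (algebraicClosure ℚ ℂ) (↑μ : Set ℂ)).restrictScalars ℚ :=
        Submodule.span_le_restrictScalars ℚ _ _
      exact Submodule.span_mono (Set.subset_insert _ _) (h2 (hΛμ hzΛ))
  choose α β hαβ using fun i => soloInformed_exists_coeffs_of_mem_span (hspan i)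
  -- Step 3: the rows `β_i` are linearly independent over `ℚ̄`
  have hrows : ∀ d : ι → algebraicClosure ℚ ℂ, ∑ i, d i • β i = 0 → d = 0 := by
    intro d hd
    have hcoef : ∀ j : μ, ∑ i, (d i : ℂ) * (β i j : ℂ) = 0 := by
      intro j
      have h1 := congr_fun hd j
      simp only [Finset.sum_apply, Pi.smul_apply, smul_eq_mul, Pi.zero_apply] at h1
      have h2 := congrArg ((↑) : algebraicClosure ℚ ℂ → ℂ) h1
      simpa using h2
    have hexp : ∑ i, (d i : ℂ) * (e i : ℂ) =
        ∑ i, (d i : ℂ) * (α i : ℂ) + ∑ j : μ, (∑ i, (d i : ℂ) * (β i j : ℂ)) * (j : ℂ) := by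
      calc ∑ i, (d i : ℂ) * (e i : ℂ)
          = ∑ i, ((d i : ℂ) * (α i : ℂ) + ∑ j : μ, (d i : ℂ) * (β i j : ℂ) * (j : ℂ)) :=
            Finset.sum_congr rfl fun i _ => by
              rw [hαβ i, mul_add, Finset.mul_sum]
              simp_rw [mul_assoc]
        _ = ∑ i, (d i : ℂ) * (α i : ℂ) + ∑ i, ∑ j : μ, (d i : ℂ) * (β i j : ℂ) * (j : ℂ) := by
            rw [Finset.sum_add_distrib]
        _ = ∑ i, (d i : ℂ) * (α i : ℂ) + ∑ j : μ, ∑ i, (d i : ℂ) * (β i j : ℂ) * (j : ℂ) := by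
            rw [Finset.sum_comm]
        _ = _ := by simp_rw [Finset.sum_mul]
    have hrel : (-(∑ i, (d i : ℂ) * (α i : ℂ))) + ∑ i, (d i : ℂ) * (e i : ℂ) = 0 := by
      rw [hexp]
      simp [hcoef]
    have halg₀ : IsAlgebraic ℚ (-(∑ i, (d i : ℂ) * (α i : ℂ))) := by
      have : (-(∑ i, (d i : ℂ) * (α i : ℂ))) = ((-(∑ i, d i * α i) : algebraicClosure ℚ ℂ) : ℂ) := by
        push_cast
        rfl
      rw [this]
      exact mem_algebraicClosure_iff.1 (SetLike.coe_mem _)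
    obtain ⟨-, hdi⟩ := soloInformed_linIndep_complexify hli halg₀
      (fun i => mem_algebraicClosure_iff.1 (d i).2) hrel
    funext i
    exact Subtype.ext (by simpa using hdi i)
  have hΦinj := soloInformed_aeval_affine_injective α β hrows
  -- Step 4: a polynomial relation among the `e_i` over `K` is one among the `μ_j` over `ℚ̄`
  rw [algebraicIndependent_iff]
  intro p hp
  set φ := soloInformedRealAlgHom with hφdef
  have hφ : Function.Injective φ := φ.injective
  apply MvPolynomial.map_injective φ hφ
  rw [map_zero]
  set p' := MvPolynomial.map φ p with hp'
  have h1 : MvPolynomial.aeval (fun i => (e i : ℂ)) p' = 0 := by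
    have hcomp : (algebraMap (algebraicClosure ℚ ℂ) ℂ).comp φ =
        (algebraMap ℝ ℂ).comp (algebraMap (algebraicClosure ℚ ℝ) ℝ) := by
      ext k
      rfl
    rw [MvPolynomial.aeval_def, hp', MvPolynomial.eval₂_map, hcomp]
    have := congrArg (algebraMap ℝ ℂ) hp
    rw [map_zero, MvPolynomial.aeval_def, MvPolynomial.eval₂_comp_left] at this
    exact this
  set Φ : MvPolynomial ι (algebraicClosure ℚ ℂ) →ₐ[algebraicClosure ℚ ℂ]
      MvPolynomial μ (algebraicClosure ℚ ℂ) := MvPolynomial.aeval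
    fun i => MvPolynomial.C (α i) + ∑ j, MvPolynomial.C (β i j) * MvPolynomial.X j with hΦ
  have h2 : (MvPolynomial.aeval ((↑) : μ → ℂ)).comp Φ = MvPolynomial.aeval fun i => (e i : ℂ) := by
    refine MvPolynomial.algHom_ext fun i => ?_
    rw [AlgHom.comp_apply, MvPolynomial.aeval_X, MvPolynomial.aeval_X]
    simp only [map_add, map_sum, map_mul, MvPolynomial.algHom_C, MvPolynomial.aeval_X, hαβ i]
    rfl
  have h3 : MvPolynomial.aeval ((↑) : μ → ℂ) (Φ p') = 0 := by
    rw [← AlgHom.comp_apply, h2, h1]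
  have h4 : Φ p' = 0 := (algebraicIndependent_iff.1 hμ) _ h3
  exact hΦinj (by rw [h4, map_zero])

end Summit.KontsevichZagierPeriods.KontsevichZagierPeriods.Theorems
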